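import Literature.NumberTheory.Sieve.PolymathMkEpsForms
import Literature.NumberTheory.Sieve.MaynardTaoTheoremProofs
import Literature.NumberTheory.Sieve.ParityBarrierLevelProofs
import HarnessLib

/-!
# Polymath 8b §7: the exact quadratic forms for `M_k` itself (`ε = 0`) and the certificate criterion

Topic `Literature/NumberTheory/Sieve`.  The tree evaluates Polymath's functionals `I(F)` and
`J_{i,1-ε}(F)` (Theorem 3.12, `M_{k,ε}`) of the symmetric-polynomial test functions
`F = 1_{(1+ε)·R_k} · Q`, `Q = ∑_{i, a ≤ D} A_{i,a} (r - P₁)^a ∏_p p_{v_p}^{ν_{i,p}}` (products of power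
sums `p_v = ∑_l t_l^v`), as the explicit finite sums `MkEps.iForm`, `MkEps.jForm` of rational numbers
(`PolymathMkEpsForms.lean`, used for the `M_{50,1/25} > 4` certificate behind `H₁ ≤ 246`).  Polymath
8b §7.1 uses the very same evaluation for `M_k` (Theorem 3.9: "`M_{54} > 4.00238`", `d = 23`;
Table 1: Krylov/polynomial lower bounds `M_{53} ≥ 3.986`, `M_{54} ≥ 4.002`): this is the case
`r = ρ = 1` of the forms, i.e. the test functions `1_{R_k} · Q` of MAYNARD's functional
`(∑_m J_k^{(m)}(F))/I_k(F)` (`maynardFunctional`, `MaynardTao.lean`).  This file records that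
specialisation and the resulting kernel certificate criterion:

* `MkEps.maynardI_cutoff_qPoly`, `MkEps.maynardJ_cutoff_qPoly` — for `F = 1_{R_k}·Q`:
  `I_k(F) = iForm v k 1 D A ν` and `J_k^{(m)}(F) = jForm v (k-1) 1 1 D A ν` for every `m`
  [cite: Polymath8b2014, §7.1 (the matrices M₁, M₂ via Lemma 7.2)];
* `MkEps.maynardFunctional_cutoff_qPoly` — `(∑_m J^{(m)})/I = k · jForm / iForm`;
* `MkEps.isMaynardAdmissible_cutoff_qPoly` — admissibility from `iForm > 0`;
* `MkEps.lt_maynardFunctional_of_forms` — **the certificate criterion for `M_k`** ("taking a rational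
  approximation … we then do the quick (and exact) arithmetic to verify that (7.4) holds for some
  constant `C > 4`", §7.1 p. 30): `0 < iForm` and `M · iForm < k · jForm` give an admissible `F` on
  `R_k` with `maynardFunctional k F > M`;
* `MkEps.weakDHL_of_forms` — with Maynard's theorem (Polymath 8b Thm 3.8 = Maynard Prop. 4.2,
  PROVED in the tree as `frequently_card_primes_ge_of_maynardFunctional_holds`) and the
  Bombieri–Vinogradov theorem (PROVED, `BombieriVinogradovStatement_holds`): an exact-rational
  certificate `4m · iForm < k · jForm` yields `DHL[k, m+1]` UNCONDITIONALLY; and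
  `MkEps.frequently_nth_prime_add_le_of_forms` — hence `p_{n+m} - p_n ≤ diam(ℋ)` infinitely often for
  any admissible `k`-tuple `ℋ` [cite: Polymath8b2014, Theorem 3.8 and p. 8].

Everything is proved (the two deep inputs are the tree's theorems); no new facts.  The
integer-arithmetic evaluation of `iForm`/`jForm` for concrete data is the pattern of
`PolymathBoundedGapsCert.lean` (there for `k = 50`, `ε = 1/25`).

## References

* D. H. J. Polymath, *Variants of the Selberg sieve, and bounded intervals containing many primes*,
  Res. Math. Sci. 1 (2014), Art. 12 = arXiv:1407.4897: §7.1 (pp. 29–30: the bases `(1-P₁)^a P_α`,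
  Lemma 7.2, the exact-arithmetic verification), Theorem 3.8, Theorem 3.9, Table 1.
  [Polymath8b2014]
* J. Maynard, *Small gaps between primes*, Ann. of Math. 181 (2015), Prop. 4.2, Lemma 7.2.
  [MaynardAnnals2015]
-/

open MeasureTheory Set Filter Finset intervalIntegral
open scoped BigOperators

noncomputable section

namespace Literature.NumberTheory.Sieve

namespace MkEps

variable {P : ℕ} {ι : Type*} [Fintype ι]

/-! ### The forms at `r = ρ = 1` are Maynard's `I_k`, `J_k^{(m)}` -/

/-- `I_k(1_{R_k} Q) = iForm` at `r = 1` (Polymath 8b §7.1: the matrix `M₁ = (⟨b_i, b_j⟩)` computed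
"as exact rational numbers, using Lemma 7.2"). [cite: Polymath8b2014, §7.1 (M₁ via Lemma 7.2)] -/
theorem maynardI_cutoff_qPoly (K : ℕ) (v : Fin P → ℕ) (D : ℕ) (A : ι → ℕ → ℝ) (ν : ι → Fin P → ℕ) :
    maynardI K ((maynardSimplex K).indicator (qPoly v 1 D A ν)) = iForm v K 1 D A ν := by
  rw [MaynardTao.maynardI_indicator_eq, ← scaledSimplex_one, integral_scaledSimplex_qPoly_sq v one_pos]

/-- `J_k^{(m)}(1_{R_k} Q) = jForm` at `r = ρ = 1`, for every place `m` (Polymath 8b §7.1: the matrix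
`M₂`, via the inner integral `∫₀^{1-∑s} Q du` and Lemma 7.2 on `R_{k-1}`).
[cite: Polymath8b2014, §7.1 (M₂ via Lemma 7.2)] -/
theorem maynardJ_cutoff_qPoly (n : ℕ) (m : Fin (n + 1)) (v : Fin P → ℕ) (D : ℕ) (A : ι → ℕ → ℝ)
    (ν : ι → Fin P → ℕ) :
    maynardJ (n + 1) m ((maynardSimplex (n + 1)).indicator (qPoly v 1 D A ν)) =
      jForm v n 1 1 D A ν := by
  rw [MaynardTao.maynardJ_indicator_eq]
  simp_rw [intervalIntegral_qPoly_insertNth]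
  rw [← scaledSimplex_one, integral_scaledSimplex_gPoly_sq v one_pos]

/-- **Maynard's functional of `1_{R_k} Q` in closed form**: `(∑_m J_k^{(m)})/I_k = k · jForm / iForm`
(`r = ρ = 1`). [cite: Polymath8b2014, §7.1 (the ratio (7.4) with M₁, M₂)] -/
theorem maynardFunctional_cutoff_qPoly (n : ℕ) (v : Fin P → ℕ) (D : ℕ) (A : ι → ℕ → ℝ)
    (ν : ι → Fin P → ℕ) :
    maynardFunctional (n + 1) ((maynardSimplex (n + 1)).indicator (qPoly v 1 D A ν)) =
      ((n + 1 : ℕ) : ℝ) * jForm v n 1 1 D A ν / iForm v (n + 1) 1 D A ν := by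
  rw [maynardFunctional, maynardI_cutoff_qPoly]
  congr 1
  rw [Finset.sum_congr rfl fun m _ => maynardJ_cutoff_qPoly n m v D A ν, Finset.sum_const,
    Finset.card_univ, Fintype.card_fin, nsmul_eq_mul]

/-- `1_{R_k} Q` is an admissible test function for `M_k` as soon as `iForm > 0`.
[cite: Polymath8b2014, §7.1 (F = 1_{R_k}·P, p. 29)] -/
theorem isMaynardAdmissible_cutoff_qPoly (K : ℕ) (v : Fin P → ℕ) (D : ℕ) (A : ι → ℕ → ℝ)
    (ν : ι → Fin P → ℕ) (hpos : 0 < iForm v K 1 D A ν) :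
    IsMaynardAdmissible K ((maynardSimplex K).indicator (qPoly v 1 D A ν)) := by
  refine MaynardTao.isMaynardAdmissible_indicator (continuous_qPoly v 1 D A ν) ?_
  rwa [← scaledSimplex_one, integral_scaledSimplex_qPoly_sq v one_pos]

/-- **The certificate criterion for `M_k`** (Polymath 8b §7.1, p. 30: "we then do the quick (and
exact) arithmetic to verify that (7.4) holds for some constant `C > 4`"): if the exact forms of the
data satisfy `iForm > 0` and `M · iForm < k · jForm` (`r = ρ = 1`), then `F = 1_{R_k} Q` is admissible
and `maynardFunctional k F > M` (so `M_k > M`). [cite: Polymath8b2014, §7.1 (exact verification of (7.4))] -/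
theorem lt_maynardFunctional_of_forms (n : ℕ) (v : Fin P → ℕ) (D : ℕ) (A : ι → ℕ → ℝ)
    (ν : ι → Fin P → ℕ) {M : ℝ} (hpos : 0 < iForm v (n + 1) 1 D A ν)
    (hlt : M * iForm v (n + 1) 1 D A ν < ((n + 1 : ℕ) : ℝ) * jForm v n 1 1 D A ν) :
    IsMaynardAdmissible (n + 1) ((maynardSimplex (n + 1)).indicator (qPoly v 1 D A ν)) ∧
      M < maynardFunctional (n + 1) ((maynardSimplex (n + 1)).indicator (qPoly v 1 D A ν)) := by
  refine ⟨isMaynardAdmissible_cutoff_qPoly (n + 1) v D A ν hpos, ?_⟩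
  rw [maynardFunctional_cutoff_qPoly, lt_div_iff₀ hpos]
  exact hlt

/-! ### From a certificate to `DHL[k, m+1]` and to gaps, unconditionally -/

/-- **`DHL[k, m+1]` from an exact certificate** (Polymath 8b Thm 3.8 = Maynard's theorem, with
Bombieri–Vinogradov): if `iForm > 0` and `4m · iForm < k · jForm` then every admissible `k`-tuple
contains `≥ m + 1` primes infinitely often.  Both deep inputs are the tree's theorems
(`frequently_card_primes_ge_of_maynardFunctional_holds`, `BombieriVinogradovStatement_holds`); the
level `θ < 1/2` is chosen with `2m/θ` between `4m` and the certified ratio.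
[cite: Polymath8b2014, Theorem 3.8 (with Theorem 2.3)] -/
theorem weakDHL_of_forms (n m : ℕ) (v : Fin P → ℕ) (D : ℕ) (A : ι → ℕ → ℝ) (ν : ι → Fin P → ℕ)
    (hpos : 0 < iForm v (n + 1) 1 D A ν)
    (hlt : 4 * (m : ℝ) * iForm v (n + 1) 1 D A ν < ((n + 1 : ℕ) : ℝ) * jForm v n 1 1 D A ν) :
    WeakDicksonHardyLittlewood (n + 1) (m + 1) := by
  set F := (maynardSimplex (n + 1)).indicator (qPoly v 1 D A ν) with hF
  obtain ⟨hadm, hM⟩ := lt_maynardFunctional_of_forms n v D A ν hpos hlt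
  set R := maynardFunctional (n + 1) F with hR
  have hR4 : 4 * (m : ℝ) < R := hM
  -- choose a level `θ < 1/2` with `2m/θ < R`
  rcases Nat.eq_zero_or_pos m with hm | hm
  · -- `m = 0`: `DHL[k, 1]` is trivial
    subst hm
    exact weakDHL_one (by omega)
  have hmR : (0 : ℝ) < m := by exact_mod_cast hm
  have hRpos : 0 < R := lt_trans (by positivity) hR4
  set θ : ℝ := 4 * m / (R + 4 * m) with hθ
  have hden : 0 < R + 4 * m := by positivity
  have hθ0 : 0 < θ := by rw [hθ]; positivity
  have hθhalf : θ < 1 / 2 := by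
    rw [hθ, div_lt_iff₀ hden]; linarith
  have hlevel : PrimesHaveLevel θ := BombieriVinogradovStatement_holds θ hθhalf
  have hMθ : 2 * (m : ℝ) / θ < R := by
    rw [hθ, div_div_eq_mul_div, div_lt_iff₀ (by positivity)]
    nlinarith
  exact weakDHL_of_maynardFunctional_gt frequently_card_primes_ge_of_maynardFunctional_holds hθ0
    hlevel hadm hMθ

/-- **Gaps from a certificate**: if `iForm > 0`, `4m · iForm < k · jForm`, and `ℋ` is an admissible
`k`-tuple of diameter `≤ d`, then `p_{n+m} ≤ p_n + d` for infinitely many `n` (Polymath 8b, p. 8: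
"`DHL[k, m+1]` implies `H_m ≤ H(k)`").  For `m = 1`, `k = 53` this is the shape of the sentence
«`M_{53} > 4 ⇒ H₁ ≤ 264`» (the narrowest admissible 53-tuple; the record `246` uses `M_{k,ε}`).
[cite: Polymath8b2014, §3 (DHL[k,m+1] ⇒ H_m ≤ H(k), p. 8)] -/
theorem frequently_nth_prime_add_le_of_forms (n m : ℕ) (v : Fin P → ℕ) (D : ℕ) (A : ι → ℕ → ℝ)
    (ν : ι → Fin P → ℕ) (hpos : 0 < iForm v (n + 1) 1 D A ν)
    (hlt : 4 * (m : ℝ) * iForm v (n + 1) 1 D A ν < ((n + 1 : ℕ) : ℝ) * jForm v n 1 1 D A ν)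
    {H : Finset ℤ} (hH : IsAdmissibleTuple H) (hk : H.card = n + 1) {d : ℕ}
    (hd : ∀ a ∈ H, ∀ b ∈ H, b - a ≤ (d : ℤ)) :
    ∃ᶠ N in atTop, Nat.nth Nat.Prime (N + m) ≤ Nat.nth Nat.Prime N + d :=
  (weakDHL_of_forms n m v D A ν hpos hlt).frequently_nth_prime_add_le hH hk hd

end MkEps

end Literature.NumberTheory.Sieve
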